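import Summits.NavierStokesRegularity.NavierStokesRegularity.Theses.DssFarFieldSlaving
import Summits.NavierStokesRegularity.NavierStokesRegularity.Theorems.FilamentSkeletonRssRdssProfileTruncation
import HarnessLib

/-!
# Route `DssFarFieldSlaving`, crux `DssTruncationBridge` (stmt-NavierStokesRegularity-14477) — PROVED

`dssTruncationBridge_proof : Theses.DssFarFieldSlaving.DssTruncationBridge`: if Tsai's Type-I
(rotated) `λ`-DSS Liouville wall fails,
`¬ (∀ c, TypeIDSSLiouville c ∧ ∀ R, RotatedTypeIDSSLiouville c R)`, then for some `ν > 0`, `T > 0`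
there is a Leray–Hopf classical solution of Navier–Stokes from a rapidly decaying datum with finite
maximal lifespan `T` (`IsMaximalSmoothSolution ν 0 u p T ∧ IsLerayHopfOn T ν 0 (u 0) u ∧
HasRapidSpatialDecay (u 0)`, the X5a shape of route `Blowup`).

## Proof

The crux is, after one `push Not`, the accepted sibling crux
`Theses.FilamentSkeletonRss.RdssProfileTruncation` (stmt-NavierStokesRegularity-11289; the route
file of `FilamentSkeletonRss` records the equivalence with the pre-restatement item stmt-0901 of this
crux), which is PROVED in tree by
`Theorems.filamentSkeletonRss_rdssProfileTruncation_proof`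
(`Theorems/FilamentSkeletonRssRdssProfileTruncation.lean`, line `Sketch` = subcritical quasi-compact
steering: smooth Oseen-gauge representative, period-map package with quasi-compact derivative,
pseudo-stable steering of a truncated datum, Oseen-classical and Leray–Hopf packaging; axioms
`propext`, `Classical.choice`, `Quot.sound`). Its hypothesis is the existence of a NONTRIVIAL Type-I
rotated-DSS ancient mild solution `u` (`1 < c`, `IsAncientMildSolution 1 u`, measurable slices,
`IsRotatedDSS c R u`, `∃ C₀, HasTypeIDecay C₀ u`, `¬ ∀ t < 0, u t =ᵐ 0`), and its conclusion is
verbatim the conclusion of `DssTruncationBridge`. The negated wall supplies exactly such a `u`: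
if no such `u` existed, every `RotatedTypeIDSSLiouville c R` would hold (this is its definition read
contrapositively), and with `R = 1` also every `TypeIDSSLiouville c`
(`rotatedTypeIDSSLiouville_refl_iff`), i.e. the wall would hold.

This file supersedes the birth skeleton `Cruxes/DssTruncationBridge/Lines/birth.lean` of the crux
(whose stubs 0 and 1 remain useful helpers and are landed separately `--supports` the item).

## References

* G. Koch, N. Nadirashvili, G. Seregin, V. Šverák, Acta Math. 203 (2009), §4
  [KochNadirashviliSereginSverak2009] (regularity of the representative, inside the sibling proof).
* Z. Bradshaw, T.-P. Tsai, Comm. PDE 42 (2017) = arXiv:1610.05680, §5 Open Problem 5.1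
  [BradshawTsai2017CPDE] (the Type-I RDSS Liouville problem = the wall).
-/

noncomputable section

set_option linter.dupNamespace false

namespace Summit.NavierStokesRegularity.NavierStokesRegularity.Theorems

open MeasureTheory Literature.Analysis.FluidPDE

/-- **The negated Type-I DSS Liouville wall yields a nontrivial Type-I rotated-DSS ancient mild
solution** (the hypothesis of the sibling crux `RdssProfileTruncation`, verbatim): if no factor
`c > 1`, isometry `R` and ancient mild `u` (`ν = 1`, measurable slices, rotated `c`-DSS, Type-I
bounded, not a.e. trivial) exist, then every `RotatedTypeIDSSLiouville c R` holds by definition, and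
with `R = 1` every `TypeIDSSLiouville c` (`rotatedTypeIDSSLiouville_refl_iff`), contradicting the
hypothesis. [cite: BradshawTsai2017CPDE, §5 Open Problem 5.1] -/
theorem exists_typeI_rdss_ancient_of_not_liouville
    (hneg : ¬ ∀ c : ℝ, TypeIDSSLiouville c ∧
      ∀ R : EuclideanSpace ℝ (Fin 3) ≃ₗᵢ[ℝ] EuclideanSpace ℝ (Fin 3), RotatedTypeIDSSLiouville c R) :
    ∃ (c : ℝ) (R : EuclideanSpace ℝ (Fin 3) ≃ₗᵢ[ℝ] EuclideanSpace ℝ (Fin 3))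
      (u : ℝ → EuclideanSpace ℝ (Fin 3) → EuclideanSpace ℝ (Fin 3)),
      1 < c ∧ IsAncientMildSolution 1 u ∧
      (∀ t < 0, AEStronglyMeasurable (u t) volume) ∧ IsRotatedDSS c R u ∧
      (∃ C₀ : ℝ, HasTypeIDecay C₀ u) ∧ ¬ (∀ t < 0, u t =ᵐ[volume] 0) := by
  by_contra hno
  push Not at hno
  refine hneg fun c => ?_
  have hrot : ∀ R : EuclideanSpace ℝ (Fin 3) ≃ₗᵢ[ℝ] EuclideanSpace ℝ (Fin 3),
      RotatedTypeIDSSLiouville c R :=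
    fun R hc u hu hmeas hdss hdec => hno c R u hc hu hmeas hdss hdec
  exact ⟨(rotatedTypeIDSSLiouville_refl_iff c).1 (hrot _), hrot⟩

/-- **Crux `DssTruncationBridge` of route `DssFarFieldSlaving` (stmt-NavierStokesRegularity-14477),
PROVED**: failure of Tsai's Type-I (rotated) `λ`-DSS Liouville wall implies the existence, for some
`ν > 0` and `T > 0`, of a Leray–Hopf classical Navier–Stokes solution from a rapidly decaying datum
with finite maximal lifespan `T`. Composition of `exists_typeI_rdss_ancient_of_not_liouville` with
the accepted sibling theorem `filamentSkeletonRss_rdssProfileTruncation_proof`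
(`Theses.FilamentSkeletonRss.RdssProfileTruncation`, stmt-NavierStokesRegularity-11289), whose
conclusion is verbatim the conclusion of this crux. [cite: KochNadirashviliSereginSverak2009, §4] -/
theorem dssTruncationBridge_proof :
    Summit.NavierStokesRegularity.NavierStokesRegularity.Theses.DssFarFieldSlaving.DssTruncationBridge := by
  intro hneg
  exact filamentSkeletonRss_rdssProfileTruncation_proof
    (exists_typeI_rdss_ancient_of_not_liouville hneg)

end Summit.NavierStokesRegularity.NavierStokesRegularity.Theorems

end
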